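import Literature.MathematicalPhysics.QuantumFieldTheory.Balaban1983to89.B9Eq343CovariantResolventHolderLetters

/-!
# `Balaban1983to89.B9Eq343CovariantResolventHolderAdjointRow` — T. Bałaban, *Propagators for lattice gauge theories in a background field*, Commun. Math. Phys. **99**
# (1985) 389–434 [Balaban1985BackgroundPropagators] Thm 3.1 (3.43) p. 398, SECOND MEMBER `‖ζG′(U)∇*_Uλ‖_β ≤ B₀(β)(L^jη)^{1−β}(…)e^{−δ₀d}|λ|`, FOR THE COVARIANT MASSIVE
# RESOLVENT ON THE SMALL-FIELD CLASS: **THE `cosh`-WEIGHTED η-SCALE HÖLDER ROW OF `(Δ_{RS} + m)⁻¹D*_S` FROM TWO DISPLAYED LETTERS — the FLAT two-point letter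
# (Hölder row of `(L₀ + m)⁻¹∂*`, [B4] (1.9) at `A = 0` for the free massive resolvent; NOT in the tree on the chain's carrier) and a covariant-gradient letter for
# `(Δ_{RS} + m)⁻¹` on weighted value data — by the SAME affine bootstrap as the value row (`B9Eq342CovariantResolventAdjointRow`): `G_mD*_Sf = z − G_mD*_Sq − G_ms +
# G_m(D*_Sf − D*_1f)`, the flat letter for `z`, the hypothesis for the `q`-term (value data!), the η-scale Lipschitz rows of `G_ms`, `G_m(D*_Sf − D*_1f)`
# (`B9Eq343CovariantResolventHolderLetters.norm_sub_le_of_gradLetter`), the two-point a-priori bound; contraction constant `κ = tεS_ad(e^a + 1)` as before**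

statement-level skeleton of published theorems with citation tags; proofs where landed; nothing here is a claim about the Yang–Mills mass gap

CITATION HEADER (lean-in-tree rule).  Audit cell `pub-balaban`, sub-cell `t4`, BINDER row NE9; filed by NE9 crux-team LEAF PROVER 01 (`b2b-balaban-t4-ne9-formalise-leaf-01`,
gen 93; bears_on: R4/N22).  Source READ first-hand (`paper:balaban1985-cmp99-background-propagators`): p. 397 (3.40) (Hölder norms; the cell reads PLAIN pair differences over
`tdist ≤ ℓ`, `ℓ = L^{n+1}`), p. 398 Thm 3.1 (3.43) second member and *«the choice of derivatives ∇_U, ∇\*_U is conventional»*; p. 394 (3.23); p. 398 the random-walk proof —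
NOT reproduced.  Inputs BY NAME: this lineage's value-row files (`B9Eq342CovariantResolventAdjointRow(Letters)`, `B5Eq129FreeResolventWeightedAdjointRow`) and
`B9Eq343CovariantResolventHolderLetters`.  Nothing printed is a hypothesis; the `[cite: …]` tags are TEXT LOCATIONS.

WHAT IS PROVED (sorry-free; proof lane — 0 `def`, no notation: `Wt`, `Sad`, `Tm` pinned by equations; the flat two-point letter `Hflat` (constant `SH`) and the gradient
letter `Hgrad` (constant `Θg`) DISPLAYED).
* §0 `affine_bootstrap`, `ratio_le_rpow` (private, [folklore]).
* §1 **`holderAdjRow_step`** — the η-scale Hölder row of `G_mD*_S` (`‖(G_mD*_Sf)(x′) − (G_mD*_Sf)(x)‖ ≤ Θ·F·(d(x,x′)∕ℓ)^β·W_{x₀}(x)` for `d(x,x′) ≤ ℓ`, value data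
  `‖f(b)‖ ≤ F·W_{x₀}(b₋)`) with constant `Θ` ⟹ the same with `A_H + κΘ`, `A_H = S_H + Lip·(t²d(ε²e^a + ε′)S_ad + tεde^a)`, `Lip = dℓ(t⁻¹Θ_∇ + ελ⁻¹)e^{ad(ℓ+1)}`.
* §2 **`holderAdjRow_covariantResolvent`** (constant `A_H∕(1 − κ)`, `κ < 1`), **`holderAdjRow_covariantResolvent_half`** (`κ ≤ ½` ⟹ `2A_H`).
HONEST SCOPE.  A REDUCTION: the Hölder member of (HLa₀) for the MASSIVE resolvent ⇐ ONE flat two-point letter + ONE gradient letter (the latter is supplied at the tower by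
the OWNER's closed gradient row of `G′_k` through `G_1 = G′_k − G′_k(1 − a′Q̃′†Q̃′)G_1`; the former is THE open analytic input: lit-balaban's kernel-checked [B4] (1.9)
`B4Thm19ZeroTorus.thm19_zero_torus` lives on the `B1RG242Torus` carrier with equal sides `2L^{m+K}`, NOT on `TSite d (towerP L m (n+1))` for general periods).  The tower
instantiation and the `G′_k`-step (HJ-3 `holderRow_of_gradientRow`) are the next files.  NOT summit progress (cell pub-balaban: NE9 NOT PRINTED ∕ NOT PROVED; «NE9 ⇐
the named binders»; row WALLED ON A MODEL (O-NE9-1; #5 UNRULED); spine PROVED 0∕9; rung (B)+1 finite T⁴ — NOT infinite volume, NOT mass gap, NOT BetaPertH, NOT Clay).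
HONEST DEPENDENCY (cell line): continuum YM on T⁴ ⇐ BetaPertH ∧ nine spine estimates (0/9 proved); BetaPertH ⇐ (D1) ∧ (D4) ∧ CAP+tail; G-an2-4 gates asym, D1 and
NE2/3/4.  NEW file; nothing modified.  Net new unproved facts: 0.
-/

noncomputable section

open scoped InnerProductSpace ComplexConjugate BigOperators

namespace Literature.MathematicalPhysics.QuantumFieldTheory.Balaban1983to89.B9Eq343CovariantResolventHolderAdjointRow

open B4Sect5Torus (TSite tdist tdist_nonneg)
open B4TorusKernel.MultiPeriod (circAbs)
open B9SectCLatticeCarrier (Bond bpos btgt shift unshift)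
open B9Eq311L2Pairing (WL2)
open B11Eq103H1Complex (SiteL2K BondL2K covDerivL2K covDivL2K covLaplaceSiteK greenK apply_greenK)
open B9Eq342GradientRowNaturalPerturbation (weight_site_shift_le weight_site_unshift_le)
open B9Eq342CovariantResolventAdjointRowLetters (rePos_covLaplaceSiteK_add norm_apply_le_weighted_of_flat_resolvent_covDiv covDiv_sub_covDiv_flat_apply
  norm_covDiv_sub_covDiv_flat_apply_le norm_q_apply_le norm_s_apply_le)
open B9Eq342CovariantResolventAdjointRow (greenK_eq_sub_greenK_pert covLaplace_sub_flat_eq sad_nonneg wt_pos)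
open B9Eq343CovariantResolventHolderLetters (norm_sub_le_of_gradLetter exists_holderAdjRow_apriori)

/-! ## §0 Two scalar lemmas -/

/-- **THE AFFINE BOOTSTRAP.**  Let `Pr : ℝ → Prop` be monotone (`Θ ≤ Θ′ → Pr Θ → Pr Θ′`) and closed from above (`(∀ ε > 0, Pr(Θ + ε)) → Pr Θ`); if `Pr Θ₀` for some
`Θ₀ ≥ 0` and `Pr Θ → Pr(A + κΘ)` for all `Θ ≥ 0` (`0 ≤ A`, `0 ≤ κ < 1`), then `Pr(A∕(1 − κ))`: the iterates `Θ_{n+1} = A + κΘ_n` satisfy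
`Θ_n ≤ A∕(1 − κ) + κⁿΘ₀` and `κⁿΘ₀ → 0`. [folklore] -/
private theorem affine_bootstrap {Pr : ℝ → Prop} (hmono : ∀ Θ Θ' : ℝ, Θ ≤ Θ' → Pr Θ → Pr Θ') (hclosed : ∀ Θ : ℝ, (∀ ε : ℝ, 0 < ε → Pr (Θ + ε)) → Pr Θ)
    {A κ Θ₀ : ℝ} (hA : 0 ≤ A) (hκ0 : 0 ≤ κ) (hκ1 : κ < 1) (hΘ₀ : 0 ≤ Θ₀) (h0 : Pr Θ₀) (hstep : ∀ Θ : ℝ, 0 ≤ Θ → Pr Θ → Pr (A + κ * Θ)) :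
    Pr (A / (1 - κ)) := by
  have h1κ : 0 < 1 - κ := sub_pos.mpr hκ1
  have hAk : 0 ≤ A / (1 - κ) := div_nonneg hA h1κ.le
  let seq : ℕ → ℝ := fun n => Nat.rec Θ₀ (fun _ Θ => A + κ * Θ) n
  have hseq0 : seq 0 = Θ₀ := rfl
  have hseqS : ∀ n, seq (n + 1) = A + κ * seq n := fun n => rfl
  have hnn : ∀ n, 0 ≤ seq n := fun n => by induction n with | zero => exact hΘ₀ | succ n ih => rw [hseqS]; positivity
  have hP : ∀ n, Pr (seq n) := fun n => by induction n with | zero => exact h0 | succ n ih => rw [hseqS]; exact hstep _ (hnn n) ih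
  have hle : ∀ n, seq n ≤ A / (1 - κ) + κ ^ n * Θ₀ := fun n => by
    induction n with
    | zero => rw [hseq0, pow_zero, one_mul]; linarith
    | succ n ih =>
        rw [hseqS, pow_succ]
        have e : A + κ * (A / (1 - κ) + κ ^ n * Θ₀) = A / (1 - κ) + κ ^ n * κ * Θ₀ := by field_simp; ring
        linarith [e, mul_le_mul_of_nonneg_left ih hκ0]
  have hPn : ∀ n, Pr (A / (1 - κ) + κ ^ n * Θ₀) := fun n => hmono _ _ (hle n) (hP n)
  refine hclosed _ fun ε hε => ?_
  rcases eq_or_lt_of_le hΘ₀ with hz | hpos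
  · have h := hPn 0
    rw [← hz, mul_zero, add_zero] at h
    exact hmono _ _ (by linarith) h
  · obtain ⟨n, hn⟩ := exists_pow_lt_of_lt_one (div_pos hε hpos) hκ1
    exact hmono _ _ (by linarith [(lt_div_iff₀ hpos).1 hn]) (hPn n)


/-- `0 ≤ r ≤ ℓ`, `0 < ℓ`, `0 < β ≤ 1` ⟹ `r∕ℓ ≤ (r∕ℓ)^β`. [folklore] -/
private theorem ratio_le_rpow {r ℓ β : ℝ} (hr : 0 ≤ r) (hrl : r ≤ ℓ) (hl : 0 < ℓ) (hβ0 : 0 < β) (hβ1 : β ≤ 1) : r / ℓ ≤ (r / ℓ) ^ β := by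
  have h0 : 0 ≤ r / ℓ := div_nonneg hr hl.le
  have h1 : r / ℓ ≤ 1 := (div_le_one hl).2 hrl
  rcases h0.eq_or_lt with hz | hpos
  · rw [← hz, Real.zero_rpow hβ0.ne']
  calc r / ℓ = (r / ℓ) ^ (1 : ℝ) := (Real.rpow_one _).symm
    _ ≤ (r / ℓ) ^ β := Real.rpow_le_rpow_of_exponent_ge hpos h1 hβ1

variable {d : ℕ} {P : Fin d → ℕ} [∀ i, NeZero (P i)] {W : Type*} [NormedAddCommGroup W] [InnerProductSpace ℂ W] [FiniteDimensional ℂ W]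
  {c₀ : ℝ} [Fact (0 < c₀)]

/-! ## §1–§2 The Hölder row: the step, the bootstrap -/

section Row

variable (t : ℝ) (ht : 0 < t) {m a ε ε' ℓ β : ℝ} (hm : 0 < m) (ha : 0 ≤ a) (hε : 0 ≤ ε) (hε' : 0 ≤ ε') (hl : 0 < ℓ) (hβ0 : 0 < β) (hβ1 : β ≤ 1)
  (hlam : 2 * (d : ℝ) * t ^ 2 * (Real.cosh a - 1) < m) (hn : ∀ ν, 2 ≤ P ν)
  (R S : Bond d P → W →ₗ[ℂ] W) (hSR : ∀ b w, S b (R b w) = w)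
  (hRn : ∀ b w, ‖R b w‖ ≤ ‖w‖) (hSn : ∀ b w, ‖S b w‖ ≤ ‖w‖)
  (hRε : ∀ b w, ‖R b w - w‖ ≤ ε * ‖w‖) (hSε : ∀ b w, ‖S b w - w‖ ≤ ε * ‖w‖)
  (hSε' : ∀ (x : TSite d P) (μ : Fin d) (w : W), ‖S (x, μ) w - S (unshift μ x, μ) w‖ ≤ ε' * ‖w‖)
  (Wt : TSite d P → TSite d P → ℝ)
  (hWt : ∀ x₀ y, Wt x₀ y = ∏ μ, Real.cosh (a * (circAbs (P μ) ((((x₀ μ : ℕ) : ZMod (P μ)) - ((y μ : ℕ) : ZMod (P μ))).val) : ℝ)))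
  (Sad : ℝ)
  (hSad : Sad = t * ∑ ν : Fin d, ((1 + Real.exp (-a)) * ((1 + 2 * t / (P ν * Real.sqrt (m - 2 * ((d : ℝ) - 1) * t ^ 2 * (Real.cosh a - 1)))) /
            Real.sqrt ((m - 2 * ((d : ℝ) - 1) * t ^ 2 * (Real.cosh a - 1)) ^ 2 + 4 * (m - 2 * ((d : ℝ) - 1) * t ^ 2 * (Real.cosh a - 1)) * t ^ 2)) +
          2 * Real.sinh a / (m - 2 * (d : ℝ) * t ^ 2 * (Real.cosh a - 1))))
  (Tm : SiteL2K ℂ d P c₀ W →ₗ[ℂ] SiteL2K ℂ d P c₀ W) (hTm : Tm = covLaplaceSiteK (t : ℂ) R S + (m : ℂ) • LinearMap.id)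
  (hpos : ∀ x : SiteL2K ℂ d P c₀ W, x ≠ 0 → 0 < RCLike.re ⟪x, Tm x⟫_ℂ)
  -- THE TWO DISPLAYED LETTERS
  (SH : ℝ) (hSH : 0 ≤ SH)
  (Hflat : ∀ (x₀ : TSite d P) (u : SiteL2K ℂ d P c₀ W) (f : BondL2K ℂ d P c₀ W) (F : ℝ), 0 ≤ F →
    covLaplaceSiteK (t : ℂ) (fun _ : Bond d P => (LinearMap.id : W →ₗ[ℂ] W)) (fun _ => LinearMap.id) u + (m : ℂ) • u =
      covDivL2K ℂ c₀ (t : ℂ) (fun _ : Bond d P => (LinearMap.id : W →ₗ[ℂ] W)) f →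
    (∀ b, ‖WL2.equiv ℂ _ W f b‖ ≤ F * Wt x₀ (bpos b)) →
    ∀ x x', tdist P x x' ≤ ℓ → ‖WL2.equiv ℂ _ W u x' - WL2.equiv ℂ _ W u x‖ ≤ SH * F * (tdist P x x' / ℓ) ^ β * Wt x₀ x)
  (Θg : ℝ) (hΘg : 0 ≤ Θg)
  (Hgrad : ∀ (x₀ : TSite d P) (g : SiteL2K ℂ d P c₀ W) (Gs : ℝ), 0 ≤ Gs → (∀ y, ‖WL2.equiv ℂ _ W g y‖ ≤ Gs * Wt x₀ y) →
    ∀ b, ‖WL2.equiv ℂ _ W (covDerivL2K ℂ c₀ (t : ℂ) R (greenK Tm hpos g)) b‖ ≤ Θg * Gs * Wt x₀ (bpos b))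

include ht hm ha hε hε' hl hβ0 hβ1 hlam hn hSR hRn hSn hRε hSε hSε' hWt hSad hTm Hflat hΘg Hgrad in
/-- **THE STEP OF THE HÖLDER BOOTSTRAP**: the η-scale Hölder row of `G_mD*_S` on VALUE data with constant `Θ` (`‖(G_mD*_Sf)(x′) − (G_mD*_Sf)(x)‖ ≤ Θ·F·(d(x,x′)∕ℓ)^β·W_{x₀}(x)`
for `d(x,x′) ≤ ℓ`) ⟹ the same with `A_H + κΘ`, `κ = tεS_ad(e^a + 1)`, `A_H = S_H + dℓ(t⁻¹Θ_∇ + ελ⁻¹)e^{ad(ℓ+1)}·(t²d(ε²e^a + ε′)S_ad + tεde^a)`.  Same decomposition as the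
value row; the flat letter for `z`, the hypothesis for the `q`-term, the η-scale Lipschitz rows for `G_ms` and `G_m(D*_Sf − D*_1f)`.
[folklore] [cite: Balaban1985BackgroundPropagators, Thm 3.1 (3.43) p.398, (3.40) p.397, (3.23) p.394, (3.35) p.396] -/
theorem holderAdjRow_step {Θ : ℝ}
    (hrow : ∀ (x₀ : TSite d P) (f : BondL2K ℂ d P c₀ W) (F : ℝ), 0 ≤ F → (∀ b, ‖WL2.equiv ℂ _ W f b‖ ≤ F * Wt x₀ (bpos b)) →
      ∀ x x', tdist P x x' ≤ ℓ → ‖WL2.equiv ℂ _ W (greenK Tm hpos (covDivL2K ℂ c₀ (t : ℂ) S f)) x' -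
        WL2.equiv ℂ _ W (greenK Tm hpos (covDivL2K ℂ c₀ (t : ℂ) S f)) x‖ ≤ Θ * F * (tdist P x x' / ℓ) ^ β * Wt x₀ x)
    (x₀ : TSite d P) (f : BondL2K ℂ d P c₀ W) (F : ℝ) (hF : 0 ≤ F) (hf : ∀ b, ‖WL2.equiv ℂ _ W f b‖ ≤ F * Wt x₀ (bpos b))
    (x x' : TSite d P) (hxx : tdist P x x' ≤ ℓ) :
    ‖WL2.equiv ℂ _ W (greenK Tm hpos (covDivL2K ℂ c₀ (t : ℂ) S f)) x' - WL2.equiv ℂ _ W (greenK Tm hpos (covDivL2K ℂ c₀ (t : ℂ) S f)) x‖ ≤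
      ((SH + d * ℓ * ((t⁻¹ * Θg + ε * (m - 2 * (d : ℝ) * t ^ 2 * (Real.cosh a - 1))⁻¹) * Real.exp (a * d * (ℓ + 1))) *
          (t ^ 2 * d * (ε ^ 2 * Real.exp a + ε') * Sad + t * ε * d * Real.exp a)) +
        (t * ε * Sad * (Real.exp a + 1)) * Θ) * F * (tdist P x x' / ℓ) ^ β * Wt x₀ x := by
  have hSad0 : 0 ≤ Sad := sad_nonneg t ht ha hlam Sad hSad
  subst hTm
  -- positivity of the flat operator
  have hRS₁ : ∀ (b : Bond d P) (v u : W), ⟪(fun _ : Bond d P => (LinearMap.id : W →ₗ[ℂ] W)) b v, u⟫_ℂ =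
      ⟪v, (fun _ : Bond d P => (LinearMap.id : W →ₗ[ℂ] W)) b u⟫_ℂ := fun _ _ _ => rfl
  have hpos₁ := rePos_covLaplaceSiteK_add (c₀ := c₀) t hm (fun _ : Bond d P => (LinearMap.id : W →ₗ[ℂ] W)) (fun _ => LinearMap.id) hRS₁
  have hlam0 : 0 < m - 2 * (d : ℝ) * t ^ 2 * (Real.cosh a - 1) := by linarith
  have hea : 1 ≤ Real.exp a := Real.one_le_exp ha
  have hW0 : ∀ y, 0 < Wt x₀ y := wt_pos (a := a) Wt hWt x₀
  set ρ : ℝ := (tdist P x x' / ℓ) ^ β with hρ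
  have hρ0 : 0 ≤ ρ := Real.rpow_nonneg (div_nonneg (tdist_nonneg _ _ _) hl.le) β
  have hr0 : 0 ≤ tdist P x x' := tdist_nonneg _ _ _
  -- data bound in the product form
  have hf' : ∀ b, ‖WL2.equiv ℂ _ W f b‖ ≤ F * ∏ μ, Real.cosh (a * (circAbs (P μ) ((((x₀ μ : ℕ) : ZMod (P μ)) - ((bpos b μ : ℕ) : ZMod (P μ))).val) : ℝ)) :=
    fun b => by rw [← hWt]; exact hf b
  -- the objects (as in the value row)
  set Gm := greenK _ hpos with hGm
  set G0 := greenK _ hpos₁ with hG0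
  set z : SiteL2K ℂ d P c₀ W := G0 (covDivL2K ℂ c₀ (t : ℂ) (fun _ : Bond d P => (LinearMap.id : W →ₗ[ℂ] W)) f) with hz
  set v := WL2.equiv ℂ _ W z with hv
  set q : BondL2K ℂ d P c₀ W := (WL2.equiv ℂ (fun _ : Bond d P => c₀) W).symm fun b : Bond d P =>
      (t : ℂ) • ((R b (v (btgt b)) - v (btgt b)) - (S b (v (bpos b)) - v (bpos b))) with hq
  set s : SiteL2K ℂ d P c₀ W := (WL2.equiv ℂ (fun _ : TSite d P => c₀) W).symm fun x : TSite d P =>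
      ((t ^ 2 : ℝ) : ℂ) • ∑ μ, ((S (unshift μ x, μ) (S (unshift μ x, μ) (v (unshift μ x)) - v (unshift μ x)) -
          (S (unshift μ x, μ) (v (unshift μ x)) - v (unshift μ x))) + (S (unshift μ x, μ) (v x) - S (x, μ) (v x))) with hs
  set Bf : SiteL2K ℂ d P c₀ W := covDivL2K ℂ c₀ (t : ℂ) S f - covDivL2K ℂ c₀ (t : ℂ) (fun _ : Bond d P => (LinearMap.id : W →ₗ[ℂ] W)) f with hBf
  have hdec : Gm (covDivL2K ℂ c₀ (t : ℂ) S f) = z - Gm (covDivL2K ℂ c₀ (t : ℂ) S q) - Gm s + Gm Bf := by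
    have e1 : covDivL2K ℂ c₀ (t : ℂ) S f = covDivL2K ℂ c₀ (t : ℂ) (fun _ : Bond d P => (LinearMap.id : W →ₗ[ℂ] W)) f + Bf := by rw [hBf]; abel
    have e2 : Gm (covDivL2K ℂ c₀ (t : ℂ) (fun _ : Bond d P => (LinearMap.id : W →ₗ[ℂ] W)) f) =
        z - Gm (covLaplaceSiteK (t : ℂ) R S z - covLaplaceSiteK (t : ℂ) (fun _ : Bond d P => (LinearMap.id : W →ₗ[ℂ] W)) (fun _ => LinearMap.id) z) := by
      rw [hGm, hz, hG0]
      exact greenK_eq_sub_greenK_pert (c₀ := c₀) (t : ℂ) (m : ℂ) R S hpos hpos₁ _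
    have e3 : covLaplaceSiteK (t : ℂ) R S z - covLaplaceSiteK (t : ℂ) (fun _ : Bond d P => (LinearMap.id : W →ₗ[ℂ] W)) (fun _ => LinearMap.id) z =
        covDivL2K ℂ c₀ (t : ℂ) S q + s := by rw [hq, hs, hv]; exact covLaplace_sub_flat_eq t R S hSR z
    rw [e1, map_add, e2, e3, map_add]
    abel
  -- `z`: its flat equation, value row and TWO-POINT letter
  have hzeq : covLaplaceSiteK (t : ℂ) (fun _ : Bond d P => (LinearMap.id : W →ₗ[ℂ] W)) (fun _ => LinearMap.id) z + (m : ℂ) • z =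
      covDivL2K ℂ c₀ (t : ℂ) (fun _ : Bond d P => (LinearMap.id : W →ₗ[ℂ] W)) f := by
    simpa only [LinearMap.add_apply, LinearMap.smul_apply, LinearMap.id_apply] using
      apply_greenK hpos₁ (covDivL2K ℂ c₀ (t : ℂ) (fun _ : Bond d P => (LinearMap.id : W →ₗ[ℂ] W)) f)
  have hzrow : ∀ y, ‖v y‖ ≤ Sad * F * Wt x₀ y := fun y => by
    rw [hWt, hSad]; exact norm_apply_le_weighted_of_flat_resolvent_covDiv (c₀ := c₀) t ht hm ha hlam hn hzeq x₀ hf' y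
  have hzh : ‖v x' - v x‖ ≤ SH * F * ρ * Wt x₀ x := Hflat x₀ z f F hF hzeq hf x x' hxx
  -- the `q`-term through the hypothesis (value data bound, as in the value row)
  have hqb : ∀ b, ‖WL2.equiv ℂ _ W q b‖ ≤ (t * ε * Sad * (Real.exp a + 1) * F) * Wt x₀ (bpos b) := fun b => by
    rw [hq, Equiv.apply_symm_apply]
    have h1 := norm_q_apply_le (P := P) t R S hRε hSε v b
    have h2 : ‖v (btgt b)‖ ≤ Sad * F * (Real.exp a * Wt x₀ (bpos b)) := by
      refine (hzrow (btgt b)).trans (mul_le_mul_of_nonneg_left ?_ (mul_nonneg hSad0 hF))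
      rw [hWt, hWt]; exact weight_site_shift_le ha x₀ b.1 b.2
    have h3 := hzrow (bpos b)
    rw [abs_of_pos ht] at h1
    calc _ ≤ t * (ε * (‖v (btgt b)‖ + ‖v (bpos b)‖)) := h1
      _ ≤ t * (ε * (Sad * F * (Real.exp a * Wt x₀ (bpos b)) + Sad * F * Wt x₀ (bpos b))) := by gcongr
      _ = (t * ε * Sad * (Real.exp a + 1) * F) * Wt x₀ (bpos b) := by ring
  have hGq : ‖WL2.equiv ℂ _ W (Gm (covDivL2K ℂ c₀ (t : ℂ) S q)) x' - WL2.equiv ℂ _ W (Gm (covDivL2K ℂ c₀ (t : ℂ) S q)) x‖ ≤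
      Θ * (t * ε * Sad * (Real.exp a + 1) * F) * ρ * Wt x₀ x := by
    rw [hGm]; exact hrow x₀ q _ (by positivity) hqb x x' hxx
  -- the `s`-term: value data bound (as in the value row), then the η-scale Lipschitz row
  have hsb : ∀ y, ‖WL2.equiv ℂ _ W s y‖ ≤ (t ^ 2 * d * (ε ^ 2 * Real.exp a + ε') * (Sad * F)) *
      ∏ μ, Real.cosh (a * (circAbs (P μ) ((((x₀ μ : ℕ) : ZMod (P μ)) - ((y μ : ℕ) : ZMod (P μ))).val) : ℝ)) := fun y => by
    rw [hs, Equiv.apply_symm_apply, ← hWt]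
    refine (norm_s_apply_le (P := P) t S hSε hSε' hε v y).trans ?_
    have hterm : ∀ μ : Fin d, ε ^ 2 * ‖v (unshift μ y)‖ + ε' * ‖v y‖ ≤ (ε ^ 2 * Real.exp a + ε') * (Sad * F) * Wt x₀ y := fun μ => by
      have h2 : ‖v (unshift μ y)‖ ≤ Sad * F * (Real.exp a * Wt x₀ y) := by
        refine (hzrow (unshift μ y)).trans (mul_le_mul_of_nonneg_left ?_ (mul_nonneg hSad0 hF))
        rw [hWt, hWt]; exact weight_site_unshift_le ha x₀ y μ
      have h3 := hzrow y
      calc ε ^ 2 * ‖v (unshift μ y)‖ + ε' * ‖v y‖ ≤ ε ^ 2 * (Sad * F * (Real.exp a * Wt x₀ y)) + ε' * (Sad * F * Wt x₀ y) := by gcongr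
        _ = (ε ^ 2 * Real.exp a + ε') * (Sad * F) * Wt x₀ y := by ring
    calc t ^ 2 * ∑ μ : Fin d, (ε ^ 2 * ‖v (unshift μ y)‖ + ε' * ‖v y‖)
        ≤ t ^ 2 * ∑ _μ : Fin d, (ε ^ 2 * Real.exp a + ε') * (Sad * F) * Wt x₀ y :=
          mul_le_mul_of_nonneg_left (Finset.sum_le_sum fun μ _ => hterm μ) (sq_nonneg t)
      _ = (t ^ 2 * d * (ε ^ 2 * Real.exp a + ε') * (Sad * F)) * Wt x₀ y := by rw [Finset.sum_const, Finset.card_univ, Fintype.card_fin, nsmul_eq_mul]; ring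
  have hseq : covLaplaceSiteK (t : ℂ) R S (Gm s) + (m : ℂ) • Gm s = s := by
    simpa only [LinearMap.add_apply, LinearMap.smul_apply, LinearMap.id_apply] using apply_greenK hpos s
  have hsb' : ∀ y, ‖WL2.equiv ℂ _ W s y‖ ≤ (t ^ 2 * d * (ε ^ 2 * Real.exp a + ε') * (Sad * F)) * Wt x₀ y := fun y => by rw [hWt]; exact hsb y
  have hsgrad : ∀ b, ‖WL2.equiv ℂ _ W (covDerivL2K ℂ c₀ (t : ℂ) R (Gm s)) b‖ ≤ Θg * (t ^ 2 * d * (ε ^ 2 * Real.exp a + ε') * (Sad * F)) * Wt x₀ (bpos b) :=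
    fun b => by rw [hGm]; exact Hgrad x₀ s _ (by positivity) hsb' b
  have hGs := norm_sub_le_of_gradLetter (c₀ := c₀) t ht R S hSR hRn hSn hε hRε hm ha hlam hseq x₀ (by positivity : 0 ≤ t ^ 2 * d * (ε ^ 2 * Real.exp a + ε') * (Sad * F)) hΘg
    hsb (fun b => by rw [← hWt]; exact hsgrad b) x x'
  -- the `Bf`-term likewise
  have hBb : ∀ y, ‖WL2.equiv ℂ _ W Bf y‖ ≤ (t * ε * d * Real.exp a * F) *
      ∏ μ, Real.cosh (a * (circAbs (P μ) ((((x₀ μ : ℕ) : ZMod (P μ)) - ((y μ : ℕ) : ZMod (P μ))).val) : ℝ)) := fun y => by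
    rw [hBf, WL2.equiv_sub, Pi.sub_apply, B11Eq103H1Complex.equiv_covDivL2K, B11Eq103H1Complex.equiv_covDivL2K, ← hWt]
    refine (norm_covDiv_sub_covDiv_flat_apply_le (P := P) t S hSε (WL2.equiv ℂ _ W f) y).trans ?_
    rw [abs_of_pos ht]
    have hterm : ∀ μ : Fin d, ‖WL2.equiv ℂ _ W f (unshift μ y, μ)‖ ≤ F * (Real.exp a * Wt x₀ y) := fun μ => by
      refine (hf (unshift μ y, μ)).trans (mul_le_mul_of_nonneg_left ?_ hF)
      rw [hWt, hWt]; exact weight_site_unshift_le ha x₀ y μ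
    calc t * (ε * ∑ μ : Fin d, ‖WL2.equiv ℂ _ W f (unshift μ y, μ)‖) ≤ t * (ε * ∑ _μ : Fin d, F * (Real.exp a * Wt x₀ y)) := by
          gcongr with μ _
          exact hterm μ
      _ = (t * ε * d * Real.exp a * F) * Wt x₀ y := by rw [Finset.sum_const, Finset.card_univ, Fintype.card_fin, nsmul_eq_mul]; ring
  have hBeq : covLaplaceSiteK (t : ℂ) R S (Gm Bf) + (m : ℂ) • Gm Bf = Bf := by
    simpa only [LinearMap.add_apply, LinearMap.smul_apply, LinearMap.id_apply] using apply_greenK hpos Bf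
  have hBb' : ∀ y, ‖WL2.equiv ℂ _ W Bf y‖ ≤ (t * ε * d * Real.exp a * F) * Wt x₀ y := fun y => by rw [hWt]; exact hBb y
  have hBgrad : ∀ b, ‖WL2.equiv ℂ _ W (covDerivL2K ℂ c₀ (t : ℂ) R (Gm Bf)) b‖ ≤ Θg * (t * ε * d * Real.exp a * F) * Wt x₀ (bpos b) :=
    fun b => by rw [hGm]; exact Hgrad x₀ Bf _ (by positivity) hBb' b
  have hGB := norm_sub_le_of_gradLetter (c₀ := c₀) t ht R S hSR hRn hSn hε hRε hm ha hlam hBeq x₀ (by positivity : 0 ≤ t * ε * d * Real.exp a * F) hΘg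
    hBb (fun b => by rw [← hWt]; exact hBgrad b) x x'
  rw [← hWt] at hGs hGB
  -- the Lipschitz bounds in the Hölder currency: `d·tdist·K(tdist)·Gs ≤ dℓK(ℓ)·Gs·ρ`
  have hLip : ∀ {Gs : ℝ}, 0 ≤ Gs →
      d * tdist P x x' * ((t⁻¹ * Θg + ε * (m - 2 * (d : ℝ) * t ^ 2 * (Real.cosh a - 1))⁻¹) * Real.exp (a * d * (tdist P x x' + 1)) * Gs) * Wt x₀ x ≤
        d * ℓ * ((t⁻¹ * Θg + ε * (m - 2 * (d : ℝ) * t ^ 2 * (Real.cosh a - 1))⁻¹) * Real.exp (a * d * (ℓ + 1))) * Gs * ρ * Wt x₀ x := by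
    intro Gs hGs
    have hK : Real.exp (a * d * (tdist P x x' + 1)) ≤ Real.exp (a * d * (ℓ + 1)) :=
      Real.exp_le_exp.2 (by nlinarith [mul_nonneg ha (Nat.cast_nonneg (α := ℝ) d)])
    have hrat : tdist P x x' ≤ ℓ * ρ := by
      have h := ratio_le_rpow hr0 hxx hl hβ0 hβ1
      rw [hρ]; rw [div_le_iff₀' hl] at h; exact h
    have hC : 0 ≤ (t⁻¹ * Θg + ε * (m - 2 * (d : ℝ) * t ^ 2 * (Real.cosh a - 1))⁻¹) := by positivity
    have h1 : (d : ℝ) * tdist P x x' ≤ d * (ℓ * ρ) := mul_le_mul_of_nonneg_left hrat (Nat.cast_nonneg d)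
    have h2 : (t⁻¹ * Θg + ε * (m - 2 * (d : ℝ) * t ^ 2 * (Real.cosh a - 1))⁻¹) * Real.exp (a * d * (tdist P x x' + 1)) * Gs ≤
        (t⁻¹ * Θg + ε * (m - 2 * (d : ℝ) * t ^ 2 * (Real.cosh a - 1))⁻¹) * Real.exp (a * d * (ℓ + 1)) * Gs :=
      mul_le_mul_of_nonneg_right (mul_le_mul_of_nonneg_left hK hC) hGs
    have h3 := mul_le_mul h1 h2 (by positivity) (by positivity)
    exact (mul_le_mul_of_nonneg_right h3 (hW0 x).le).trans (le_of_eq (by ring))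
  -- assemble
  rw [hdec]
  simp only [WL2.equiv_add, WL2.equiv_sub, Pi.add_apply, Pi.sub_apply]
  rw [← hv]
  have e : v x' - WL2.equiv ℂ _ W (Gm (covDivL2K ℂ c₀ (t : ℂ) S q)) x' - WL2.equiv ℂ _ W (Gm s) x' + WL2.equiv ℂ _ W (Gm Bf) x' -
      (v x - WL2.equiv ℂ _ W (Gm (covDivL2K ℂ c₀ (t : ℂ) S q)) x - WL2.equiv ℂ _ W (Gm s) x + WL2.equiv ℂ _ W (Gm Bf) x) =
      (v x' - v x) - (WL2.equiv ℂ _ W (Gm (covDivL2K ℂ c₀ (t : ℂ) S q)) x' - WL2.equiv ℂ _ W (Gm (covDivL2K ℂ c₀ (t : ℂ) S q)) x) -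
        (WL2.equiv ℂ _ W (Gm s) x' - WL2.equiv ℂ _ W (Gm s) x) + (WL2.equiv ℂ _ W (Gm Bf) x' - WL2.equiv ℂ _ W (Gm Bf) x) := by abel
  rw [e]
  calc ‖(v x' - v x) - (WL2.equiv ℂ _ W (Gm (covDivL2K ℂ c₀ (t : ℂ) S q)) x' - WL2.equiv ℂ _ W (Gm (covDivL2K ℂ c₀ (t : ℂ) S q)) x) -
        (WL2.equiv ℂ _ W (Gm s) x' - WL2.equiv ℂ _ W (Gm s) x) + (WL2.equiv ℂ _ W (Gm Bf) x' - WL2.equiv ℂ _ W (Gm Bf) x)‖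
      ≤ ‖v x' - v x‖ + ‖WL2.equiv ℂ _ W (Gm (covDivL2K ℂ c₀ (t : ℂ) S q)) x' - WL2.equiv ℂ _ W (Gm (covDivL2K ℂ c₀ (t : ℂ) S q)) x‖ +
          ‖WL2.equiv ℂ _ W (Gm s) x' - WL2.equiv ℂ _ W (Gm s) x‖ + ‖WL2.equiv ℂ _ W (Gm Bf) x' - WL2.equiv ℂ _ W (Gm Bf) x‖ :=
        (norm_add_le _ _).trans (add_le_add ((norm_sub_le _ _).trans (add_le_add (norm_sub_le _ _) le_rfl)) le_rfl)
    _ ≤ SH * F * ρ * Wt x₀ x + Θ * (t * ε * Sad * (Real.exp a + 1) * F) * ρ * Wt x₀ x +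
          d * ℓ * ((t⁻¹ * Θg + ε * (m - 2 * (d : ℝ) * t ^ 2 * (Real.cosh a - 1))⁻¹) * Real.exp (a * d * (ℓ + 1))) *
            (t ^ 2 * d * (ε ^ 2 * Real.exp a + ε') * (Sad * F)) * ρ * Wt x₀ x +
          d * ℓ * ((t⁻¹ * Θg + ε * (m - 2 * (d : ℝ) * t ^ 2 * (Real.cosh a - 1))⁻¹) * Real.exp (a * d * (ℓ + 1))) *
            (t * ε * d * Real.exp a * F) * ρ * Wt x₀ x :=
        add_le_add (add_le_add (add_le_add hzh hGq) (hGs.trans (hLip (by positivity)))) (hGB.trans (hLip (by positivity)))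
    _ = _ := by ring

include ht hm ha hε hε' hl hβ0 hβ1 hlam hn hSR hRn hSn hRε hSε hSε' hWt hSad hTm hSH Hflat hΘg Hgrad in
/-- **THE `cosh`-WEIGHTED η-SCALE HÖLDER ROW OF THE COVARIANT MASSIVE RESOLVENT's ADJOINT** ([B9] Thm 3.1 (3.43), second member, for `(Δ^η_U + m)⁻¹D*_U` on the
small-field class, abstract transporters, MODULO the flat two-point letter `Hflat` and the gradient letter `Hgrad`): if `κ := tεS_ad(e^a + 1) < 1` then for every
centre `x₀`, `F ≥ 0`, bond datum with `‖f(b)‖ ≤ F·W_{x₀}(b₋)` and sites with `d(x,x′) ≤ ℓ`: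
`‖((Δ_{RS}+m)⁻¹D*_Sf)(x′) − ((Δ_{RS}+m)⁻¹D*_Sf)(x)‖ ≤ A_H∕(1 − κ)·F·(d(x,x′)∕ℓ)^β·W_{x₀}(x)`. [cite: Balaban1985BackgroundPropagators, Thm 3.1 (3.43) p.398, (3.40) p.397, (3.23) p.394] -/
theorem holderAdjRow_covariantResolvent (hκ : t * ε * Sad * (Real.exp a + 1) < 1)
    (x₀ : TSite d P) (f : BondL2K ℂ d P c₀ W) (F : ℝ) (hF : 0 ≤ F) (hf : ∀ b, ‖WL2.equiv ℂ _ W f b‖ ≤ F * Wt x₀ (bpos b))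
    (x x' : TSite d P) (hxx : tdist P x x' ≤ ℓ) :
    ‖WL2.equiv ℂ _ W (greenK Tm hpos (covDivL2K ℂ c₀ (t : ℂ) S f)) x' - WL2.equiv ℂ _ W (greenK Tm hpos (covDivL2K ℂ c₀ (t : ℂ) S f)) x‖ ≤
      ((SH + d * ℓ * ((t⁻¹ * Θg + ε * (m - 2 * (d : ℝ) * t ^ 2 * (Real.cosh a - 1))⁻¹) * Real.exp (a * d * (ℓ + 1))) *
          (t ^ 2 * d * (ε ^ 2 * Real.exp a + ε') * Sad + t * ε * d * Real.exp a)) /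
        (1 - t * ε * Sad * (Real.exp a + 1))) * F * (tdist P x x' / ℓ) ^ β * Wt x₀ x := by
  have hlam0 : 0 < m - 2 * (d : ℝ) * t ^ 2 * (Real.cosh a - 1) := by linarith
  have hSad0 : 0 ≤ Sad := sad_nonneg t ht ha hlam Sad hSad
  have hW0 : ∀ x₀ y : TSite d P, 0 < Wt x₀ y := wt_pos (a := a) Wt hWt
  obtain ⟨Θ₀, hΘ₀, h0⟩ := exists_holderAdjRow_apriori (P := P) (c₀ := c₀) (W := W) t (a := a) ha hl hβ0 S Wt hWt Tm hpos
  have key := affine_bootstrap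
    (Pr := fun Θ : ℝ => ∀ (x₀ : TSite d P) (f : BondL2K ℂ d P c₀ W) (F : ℝ), 0 ≤ F → (∀ b, ‖WL2.equiv ℂ _ W f b‖ ≤ F * Wt x₀ (bpos b)) →
      ∀ x x', tdist P x x' ≤ ℓ → ‖WL2.equiv ℂ _ W (greenK Tm hpos (covDivL2K ℂ c₀ (t : ℂ) S f)) x' -
        WL2.equiv ℂ _ W (greenK Tm hpos (covDivL2K ℂ c₀ (t : ℂ) S f)) x‖ ≤ Θ * F * (tdist P x x' / ℓ) ^ β * Wt x₀ x)
    (fun Θ Θ' hle hP x₀ f F hF hf x x' hxx => (hP x₀ f F hF hf x x' hxx).trans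
      (mul_le_mul_of_nonneg_right (mul_le_mul_of_nonneg_right (mul_le_mul_of_nonneg_right hle hF)
        (Real.rpow_nonneg (div_nonneg (tdist_nonneg _ _ _) hl.le) β)) (hW0 x₀ x).le))
    (fun Θ hP x₀ f F hF hf x x' hxx => by
      refine le_of_forall_pos_le_add fun δ hδ => ?_
      have hq0 : 0 ≤ F * (tdist P x x' / ℓ) ^ β * Wt x₀ x :=
        mul_nonneg (mul_nonneg hF (Real.rpow_nonneg (div_nonneg (tdist_nonneg _ _ _) hl.le) β)) (hW0 x₀ x).le
      rcases eq_or_lt_of_le hq0 with h0' | hpos'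
      · have h := hP 1 one_pos x₀ f F hF hf x x' hxx
        have e1 : ∀ Θ' : ℝ, Θ' * F * (tdist P x x' / ℓ) ^ β * Wt x₀ x = Θ' * (F * (tdist P x x' / ℓ) ^ β * Wt x₀ x) := fun Θ' => by ring
        rw [e1, ← h0', mul_zero] at h ⊢; rw [zero_add]; exact h.trans hδ.le
      · have h := hP (δ / (F * (tdist P x x' / ℓ) ^ β * Wt x₀ x)) (div_pos hδ hpos') x₀ f F hF hf x x' hxx
        have e : (Θ + δ / (F * (tdist P x x' / ℓ) ^ β * Wt x₀ x)) * F * (tdist P x x' / ℓ) ^ β * Wt x₀ x =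
            Θ * F * (tdist P x x' / ℓ) ^ β * Wt x₀ x + δ / (F * (tdist P x x' / ℓ) ^ β * Wt x₀ x) * (F * (tdist P x x' / ℓ) ^ β * Wt x₀ x) := by ring
        rw [div_mul_cancel₀ _ hpos'.ne'] at e
        linarith [e])
    (A := SH + d * ℓ * ((t⁻¹ * Θg + ε * (m - 2 * (d : ℝ) * t ^ 2 * (Real.cosh a - 1))⁻¹) * Real.exp (a * d * (ℓ + 1))) *
          (t ^ 2 * d * (ε ^ 2 * Real.exp a + ε') * Sad + t * ε * d * Real.exp a))
    (κ := t * ε * Sad * (Real.exp a + 1)) (by positivity) (by positivity) hκ hΘ₀ h0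
    (fun Θ _ hP x₀ f F hF hf x x' hxx =>
      holderAdjRow_step (P := P) (c₀ := c₀) t ht hm ha hε hε' hl hβ0 hβ1 hlam hn R S hSR hRn hSn hRε hSε hSε' Wt hWt Sad hSad Tm hTm hpos SH Hflat Θg hΘg Hgrad
        hP x₀ f F hF hf x x' hxx)
  exact key x₀ f F hF hf x x' hxx

include ht hm ha hε hε' hl hβ0 hβ1 hlam hn hSR hRn hSn hRε hSε hSε' hWt hSad hTm hSH Hflat hΘg Hgrad in
/-- **… WITH THE CONSTANT `2A_H` WHEN `κ ≤ ½`.** [cite: Balaban1985BackgroundPropagators, Thm 3.1 (3.43) p.398, (3.35) p.396] -/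
theorem holderAdjRow_covariantResolvent_half (hκ : t * ε * Sad * (Real.exp a + 1) ≤ 1 / 2)
    (x₀ : TSite d P) (f : BondL2K ℂ d P c₀ W) (F : ℝ) (hF : 0 ≤ F) (hf : ∀ b, ‖WL2.equiv ℂ _ W f b‖ ≤ F * Wt x₀ (bpos b))
    (x x' : TSite d P) (hxx : tdist P x x' ≤ ℓ) :
    ‖WL2.equiv ℂ _ W (greenK Tm hpos (covDivL2K ℂ c₀ (t : ℂ) S f)) x' - WL2.equiv ℂ _ W (greenK Tm hpos (covDivL2K ℂ c₀ (t : ℂ) S f)) x‖ ≤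
      (2 * (SH + d * ℓ * ((t⁻¹ * Θg + ε * (m - 2 * (d : ℝ) * t ^ 2 * (Real.cosh a - 1))⁻¹) * Real.exp (a * d * (ℓ + 1))) *
          (t ^ 2 * d * (ε ^ 2 * Real.exp a + ε') * Sad + t * ε * d * Real.exp a))) * F * (tdist P x x' / ℓ) ^ β * Wt x₀ x := by
  have hlam0 : 0 < m - 2 * (d : ℝ) * t ^ 2 * (Real.cosh a - 1) := by linarith
  have hSad0 : 0 ≤ Sad := sad_nonneg t ht ha hlam Sad hSad
  have h := holderAdjRow_covariantResolvent (P := P) (c₀ := c₀) t ht hm ha hε hε' hl hβ0 hβ1 hlam hn R S hSR hRn hSn hRε hSε hSε' Wt hWt Sad hSad Tm hTm hpos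
    SH hSH Hflat Θg hΘg Hgrad (by linarith) x₀ f F hF hf x x' hxx
  refine h.trans (mul_le_mul_of_nonneg_right (mul_le_mul_of_nonneg_right (mul_le_mul_of_nonneg_right ?_ hF)
    (Real.rpow_nonneg (div_nonneg (tdist_nonneg _ _ _) hl.le) β)) (wt_pos (a := a) Wt hWt x₀ x).le)
  rw [div_le_iff₀ (by linarith)]
  have hA : 0 ≤ SH + d * ℓ * ((t⁻¹ * Θg + ε * (m - 2 * (d : ℝ) * t ^ 2 * (Real.cosh a - 1))⁻¹) * Real.exp (a * d * (ℓ + 1))) *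
      (t ^ 2 * d * (ε ^ 2 * Real.exp a + ε') * Sad + t * ε * d * Real.exp a) := by positivity
  nlinarith

end Row

end Literature.MathematicalPhysics.QuantumFieldTheory.Balaban1983to89.B9Eq343CovariantResolventHolderAdjointRow

end
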